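import Mathlib
import Literature.Analysis.FluidPDE.NSBoundedSpatialHolder
import Literature.Analysis.FluidPDE.LeraySeparationOfEnergyTools
import Summits.NavierStokesRegularity.NavierStokesRegularity.Theorems.EulerZoomLiouvillePowerGaugeEulerLiouvilleWeakBeltramiSlice
import Summits.NavierStokesRegularity.NavierStokesRegularity.Theorems.EulerZoomLiouvillePowerGaugeEulerLiouvilleGeneralizedBeltramiPast
import Summits.NavierStokesRegularity.NavierStokesRegularity.Theorems.EulerZoomLiouvillePowerGaugeEulerLiouvilleDSSEndpointSlices
import HarnessLib

/-!
# Crux `EulerZoomLiouville.PowerGaugeEulerLiouville` (stmt-NavierStokesRegularity-19832), stub `stub_nonSelfSimilarRest`: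
# NO BELTRAMI PAST — weak members whose Lamb vector `ω × u` vanishes a.e. on a past slab are trivial

Helper file (theorems only; `--supports stmt-NavierStokesRegularity-19832`; def-free).  Hand leafhand-ns-eulerzoomliouville-10 g3; assembles
`…WeakLambIdentity` / `…WeakBeltramiSlice` (weak Beltrami slices have vanishing velocity-tested Lamb curl) with `…GeneralizedBeltramiPast`
(`Loc.ae_eq_zero_of_aeSliceLambCurlFree`: vanishing velocity-tested Lamb curl on a.e. past slice ⇒ frozen vorticity ⇒ trivial).

* `Loc.ae_eq_zero_of_aeBeltramiPast` — MEMBER LEVEL, every `ρ > 0`, no regularity beyond the class, no ansatz: crux hypotheses verbatim and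
  the POINTWISE (a.e.) Beltrami condition on the past slab `(−∞,T₁) × ℝ³`, `T₁ ≤ 0`, in the language of the weak gradient `H`:
  `⟪H(t,x) u(t,x), w⟫ = ⟪H(t,x) w, u(t,x)⟫` for all `w` (i.e. `(H − Hᵀ)u = ω × u = 0`) ⇒ `u = 0` a.e.;
* `Birth.nonSelfSimilar_of_aeBeltramiPast` — binder language; the non-self-similar, regularity-free twin of hand g1's
  `Birth.selfSimilarC2Needle_of_beltrami`.
Slice regularity used: a.e. slice `u(t)` has the whole-space weak gradient `H(t)` (`FrameSteady.ae_hasWeakFDerivOn_slice_past`), `u(t), H(t) ∈ L²_loc`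
(`ae_slice_locallyIntegrable`; `H = G` a.e. for the class's `L²_loc` gradient `G`, `HasWeakSpatialGradientOn.ae_eq`), `tr H(t) = 0` a.e.
(`SerrinBoundedHolder.ae_trace_eq_zero`).

WHAT THIS IS NOT: not a proof of the stub or of the crux (the generic member has `ω × u ≠ 0`); nothing about Navier–Stokes.
[folklore; MajdaBertozziCUP2002 §2.4 (Beltrami flows)]
-/

noncomputable section

-- flat `Theorems/<Route><Decl>…` files of one crux share the namespace of the crux (tree convention)
set_option linter.dupNamespace false

open MeasureTheory Set Filter Topology Metric Function TopologicalSpace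
open scoped RealInnerProductSpace NNReal ENNReal ContDiff

namespace Summit.NavierStokesRegularity.NavierStokesRegularity.Theorems.PowerGaugeEulerLiouville

open Literature.Analysis Literature.Analysis.FunctionSpaces Literature.Analysis.FluidPDE

/-- **NO BELTRAMI PAST** (member level, every `ρ > 0`).  Crux hypotheses verbatim, `T₁ ≤ 0`, and for a.e. `(t,x) ∈ (−∞,T₁) × ℝ³` the Lamb vector
vanishes: `⟪H(t,x) u(t,x), w⟫ = ⟪H(t,x) w, u(t,x)⟫` for all `w`.  Then `u = 0` a.e. on the slab. [folklore; MajdaBertozziCUP2002 §2.4] -/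
theorem Loc.ae_eq_zero_of_aeBeltramiPast {ρ : ℝ} (hρ : 0 < ρ)
    {u : ℝ → EuclideanSpace ℝ (Fin 3) → EuclideanSpace ℝ (Fin 3)} {p : ℝ → EuclideanSpace ℝ (Fin 3) → ℝ}
    {H : ℝ → EuclideanSpace ℝ (Fin 3) → EuclideanSpace ℝ (Fin 3) →L[ℝ] EuclideanSpace ℝ (Fin 3)} {c : ℝ≥0}
    (hsw : IsSuitableWeakSolutionOn (slab (EuclideanSpace ℝ (Fin 3)) (Iio 0) isOpen_Iio) 0 0 u p)
    (hH : HasWeakSpatialGradientOn (slab (EuclideanSpace ℝ (Fin 3)) (Iio 0) isOpen_Iio) u H)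
    (hgauge : ∀ a : ℝ, 0 < a →
      ENNReal.ofReal (a ^ (2 * ρ)) * cknA a (0 : ℝ × EuclideanSpace ℝ (Fin 3)) u +
          ENNReal.ofReal (a ^ ρ) * cknE a (0 : ℝ × EuclideanSpace ℝ (Fin 3)) H +
        ENNReal.ofReal (a ^ (2 * ρ)) * cknD a (0 : ℝ × EuclideanSpace ℝ (Fin 3)) p ≤ (c : ℝ≥0∞))
    {T₁ : ℝ} (hT₁ : T₁ ≤ 0)
    (hLamb : ∀ᵐ z ∂(volume.restrict (Iio T₁ ×ˢ (univ : Set (EuclideanSpace ℝ (Fin 3))))),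
      ∀ w : EuclideanSpace ℝ (Fin 3), ⟪H z.1 z.2 (u z.1 z.2), w⟫ = ⟪H z.1 z.2 w, u z.1 z.2⟫) :
    uncurry u =ᵐ[volume.restrict (Iio (0 : ℝ) ×ˢ (univ : Set (EuclideanSpace ℝ (Fin 3))))] 0 := by
  have hdist := hsw.distributional
  have hprod : ∀ S : Set ℝ, (volume.restrict (S ×ˢ (univ : Set (EuclideanSpace ℝ (Fin 3)))) : Measure (ℝ × EuclideanSpace ℝ (Fin 3))) =
      ((volume : Measure ℝ).restrict S).prod (volume : Measure (EuclideanSpace ℝ (Fin 3))) := by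
    intro S
    rw [Measure.volume_eq_prod, ← Measure.restrict_univ (μ := (volume : Measure (EuclideanSpace ℝ (Fin 3)))),
      Measure.prod_restrict, Measure.restrict_univ]
  -- (1) a.e. slice has the weak gradient `H t`
  have h1 : ∀ᵐ t ∂(volume.restrict (Iio T₁)),
      HasWeakFDerivOn (⊤ : Opens (EuclideanSpace ℝ (Fin 3))) volume (u t) (H t) := FrameSteady.ae_hasWeakFDerivOn_slice_past hH hT₁
  -- (2) `|u(t)|² ∈ L¹_loc` for a.e. slice
  have h2 : ∀ᵐ t ∂(volume.restrict (Iio T₁)), LocallyIntegrable (fun x => ‖u t x‖ ^ 2) volume := by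
    have hu2 : LocallyIntegrableOn (fun z => ‖uncurry u z‖ ^ 2)
        ((slab (EuclideanSpace ℝ (Fin 3)) (Iio 0) isOpen_Iio : Opens (ℝ × EuclideanSpace ℝ (Fin 3))) : Set (ℝ × EuclideanSpace ℝ (Fin 3))) volume :=
      hdist.2.1
    have h := ae_slice_locallyIntegrable (g := fun z : ℝ × EuclideanSpace ℝ (Fin 3) => ‖uncurry u z‖ ^ 2)
      (fun K hK hKQ => hu2.integrableOn_compact_subset hKQ hK)
    rw [ae_restrict_iff' measurableSet_Iio]
    filter_upwards [h] with t ht htT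
    exact ht (lt_of_lt_of_le htT hT₁)
  -- (3) `|H(t)|² ∈ L¹_loc` for a.e. slice (the class's `L²_loc` gradient agrees with `H` a.e.)
  have h3 : ∀ᵐ t ∂(volume.restrict (Iio T₁)), LocallyIntegrable (fun x => ‖H t x‖ ^ 2) volume := by
    obtain ⟨G, hG, hG2, -⟩ := hsw.localEnergy
    have hae := hH.ae_eq hG
    have hHm : AEStronglyMeasurable (uncurry H)
        (volume.restrict ((slab (EuclideanSpace ℝ (Fin 3)) (Iio 0) isOpen_Iio : Opens (ℝ × EuclideanSpace ℝ (Fin 3))) :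
          Set (ℝ × EuclideanSpace ℝ (Fin 3)))) := hH.locallyIntegrableOn_grad.aestronglyMeasurable
    have hK : ∀ K : Set (ℝ × EuclideanSpace ℝ (Fin 3)), IsCompact K →
        K ⊆ ((slab (EuclideanSpace ℝ (Fin 3)) (Iio 0) isOpen_Iio : Opens (ℝ × EuclideanSpace ℝ (Fin 3))) : Set (ℝ × EuclideanSpace ℝ (Fin 3))) →
        IntegrableOn (fun z : ℝ × EuclideanSpace ℝ (Fin 3) => ‖uncurry H z‖ ^ 2) K volume := by
      intro K hKc hKQ
      have hm : AEStronglyMeasurable (fun z : ℝ × EuclideanSpace ℝ (Fin 3) => ‖uncurry H z‖ ^ 2) (volume.restrict K) :=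
        ((hHm.mono_set hKQ).norm.pow 2)
      refine ⟨hm, ?_⟩
      have hfin := hG2 K hKQ hKc
      have haeK : ∀ᵐ z ∂(volume.restrict K), uncurry H z = uncurry G z := ae_restrict_of_ae_restrict_of_subset hKQ hae
      refine lt_of_le_of_lt ?_ hfin
      refine lintegral_mono_ae ?_
      filter_upwards [haeK] with z hz
      rw [← ofReal_norm, norm_pow, norm_norm]
      refine ENNReal.ofReal_le_ofReal ?_
      have := norm_sq_le_frobeniusNormSq (G z.1 z.2)
      have e : uncurry H z = G z.1 z.2 := hz
      rw [e]
      exact this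
    have h := ae_slice_locallyIntegrable (g := fun z : ℝ × EuclideanSpace ℝ (Fin 3) => ‖uncurry H z‖ ^ 2) hK
    rw [ae_restrict_iff' measurableSet_Iio]
    filter_upwards [h] with t ht htT
    exact ht (lt_of_lt_of_le htT hT₁)
  -- (4) trace-free slices
  have h4 : ∀ᵐ t ∂(volume.restrict (Iio T₁)), ∀ᵐ x ∂(volume : Measure (EuclideanSpace ℝ (Fin 3))),
      ∑ j, ⟪(EuclideanSpace.basisFun (Fin 3) ℝ) j, H t x ((EuclideanSpace.basisFun (Fin 3) ℝ) j)⟫ = 0 := by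
    have htr := SerrinBoundedHolder.ae_trace_eq_zero hdist hH
    have h' : ∀ᵐ z ∂(volume.restrict (Iio T₁ ×ˢ (univ : Set (EuclideanSpace ℝ (Fin 3))))),
        ∑ j, H z.1 z.2 (EuclideanSpace.single j (1 : ℝ)) j = 0 := by
      rw [ae_restrict_iff' (measurableSet_Iio.prod MeasurableSet.univ)]
      filter_upwards [htr] with z hz hmem
      exact hz (by
        have : z.1 < 0 := lt_of_lt_of_le (mem_prod.1 hmem).1 hT₁
        simpa [slab] using this)
    rw [hprod] at h'
    filter_upwards [Measure.ae_ae_of_ae_prod h'] with t ht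
    filter_upwards [ht] with x hx
    rw [← hx]
    refine Finset.sum_congr rfl fun j _ => ?_
    rw [EuclideanSpace.basisFun_apply, EuclideanSpace.inner_single_left]
    simp
  -- (5) Lamb-free slices
  have h5 : ∀ᵐ t ∂(volume.restrict (Iio T₁)), ∀ᵐ x ∂(volume : Measure (EuclideanSpace ℝ (Fin 3))),
      ∀ w : EuclideanSpace ℝ (Fin 3), ⟪H t x (u t x), w⟫ = ⟪H t x w, u t x⟫ := by
    rw [hprod] at hLamb
    exact Measure.ae_ae_of_ae_prod hLamb
  -- assemble
  refine Loc.ae_eq_zero_of_aeSliceLambCurlFree hρ hsw hH hgauge hT₁ ?_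
  filter_upwards [h1, h2, h3, h4, h5] with t ht1 ht2 ht3 ht4 ht5
  intro g hg a c'
  exact LambIdentity.integral_inner_fderiv_apply_self_eq_zero_of_lambFree ht1 ht2 ht3 ht4 ht5 (isTestFunctionOn_curlPair hg a c')
    (isDivFree_curlPair_of_contDiff (hg.contDiff.of_le (by norm_cast)) a c')

/-- **Binder language: NO MEMBER IS BELTRAMI IN ITS FAR PAST** (every `ρ > 0`, no regularity beyond the class, no ansatz): a class member whose
Lamb vector `ω × u = (H − Hᵀ)u` vanishes for a.e. `(t,x) ∈ (−∞,T₁) × ℝ³`, some `T₁ ≤ 0`, is trivial — a closed sub-stratum of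
`stub_nonSelfSimilarRest`, the non-self-similar regularity-free twin of `Birth.selfSimilarC2Needle_of_beltrami`. [folklore] -/
theorem Birth.nonSelfSimilar_of_aeBeltramiPast :
    ∀ ρ : ℝ, 0 < ρ →
      ∀ (u : ℝ → EuclideanSpace ℝ (Fin 3) → EuclideanSpace ℝ (Fin 3)) (p : ℝ → EuclideanSpace ℝ (Fin 3) → ℝ)
        (H : ℝ → EuclideanSpace ℝ (Fin 3) → EuclideanSpace ℝ (Fin 3) →L[ℝ] EuclideanSpace ℝ (Fin 3)) (c : ℝ≥0),
        Birth.InClass ρ u p H c →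
          (∃ T₁ : ℝ, T₁ ≤ 0 ∧ ∀ᵐ z ∂(volume.restrict (Iio T₁ ×ˢ (univ : Set (EuclideanSpace ℝ (Fin 3))))),
              ∀ w : EuclideanSpace ℝ (Fin 3), ⟪H z.1 z.2 (u z.1 z.2), w⟫ = ⟪H z.1 z.2 w, u z.1 z.2⟫) →
          uncurry u =ᵐ[volume.restrict (Iio (0 : ℝ) ×ˢ (univ : Set (EuclideanSpace ℝ (Fin 3))))] 0 := by
  intro ρ hρ u p H c hcl h
  obtain ⟨T₁, hT₁, hLamb⟩ := h
  exact Loc.ae_eq_zero_of_aeBeltramiPast hρ hcl.1 hcl.2.1 hcl.2.2 hT₁ hLamb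

/-! ## Generalised Beltrami: the Lamb vector weakly a gradient (hand g3, append) -/

/-- **NO GENERALISED-BELTRAMI PAST, POINTWISE LAMB VECTOR FORM** (member level, every `ρ > 0`).  Crux hypotheses verbatim, `T₁ ≤ 0`, and for a.e.
`t < T₁` the Lamb vector `(H − Hᵀ)u` of the slice is WEAKLY A GRADIENT: `∫ (⟪H u, η⟫ − ⟪H η, u⟫) dx = 0` for every curl pair `η = (∂ₐg)c − (∂_c g)a`.
Then `u = 0` a.e. on the slab (the weak Lamb identity turns the hypothesis into the velocity-tested form of `Loc.ae_eq_zero_of_aeSliceLambCurlFree`).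
[folklore; MajdaBertozziCUP2002 §2.4] -/
theorem Loc.ae_eq_zero_of_aeLambGradientPast {ρ : ℝ} (hρ : 0 < ρ)
    {u : ℝ → EuclideanSpace ℝ (Fin 3) → EuclideanSpace ℝ (Fin 3)} {p : ℝ → EuclideanSpace ℝ (Fin 3) → ℝ}
    {H : ℝ → EuclideanSpace ℝ (Fin 3) → EuclideanSpace ℝ (Fin 3) →L[ℝ] EuclideanSpace ℝ (Fin 3)} {c : ℝ≥0}
    (hsw : IsSuitableWeakSolutionOn (slab (EuclideanSpace ℝ (Fin 3)) (Iio 0) isOpen_Iio) 0 0 u p)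
    (hH : HasWeakSpatialGradientOn (slab (EuclideanSpace ℝ (Fin 3)) (Iio 0) isOpen_Iio) u H)
    (hgauge : ∀ a : ℝ, 0 < a →
      ENNReal.ofReal (a ^ (2 * ρ)) * cknA a (0 : ℝ × EuclideanSpace ℝ (Fin 3)) u +
          ENNReal.ofReal (a ^ ρ) * cknE a (0 : ℝ × EuclideanSpace ℝ (Fin 3)) H +
        ENNReal.ofReal (a ^ (2 * ρ)) * cknD a (0 : ℝ × EuclideanSpace ℝ (Fin 3)) p ≤ (c : ℝ≥0∞))
    {T₁ : ℝ} (hT₁ : T₁ ≤ 0)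
    (hLamb : ∀ᵐ t ∂(volume.restrict (Iio T₁)),
      ∀ g : EuclideanSpace ℝ (Fin 3) → ℝ, IsTestFunctionOn (⊤ : Opens (EuclideanSpace ℝ (Fin 3))) g → ∀ a b : EuclideanSpace ℝ (Fin 3),
        ∫ x, (⟪H t x (u t x), fderiv ℝ g x a • b - fderiv ℝ g x b • a⟫ - ⟪H t x (fderiv ℝ g x a • b - fderiv ℝ g x b • a), u t x⟫) = 0) :
    uncurry u =ᵐ[volume.restrict (Iio (0 : ℝ) ×ˢ (univ : Set (EuclideanSpace ℝ (Fin 3))))] 0 := by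
  have hdist := hsw.distributional
  have hprod : ∀ S : Set ℝ, (volume.restrict (S ×ˢ (univ : Set (EuclideanSpace ℝ (Fin 3)))) : Measure (ℝ × EuclideanSpace ℝ (Fin 3))) =
      ((volume : Measure ℝ).restrict S).prod (volume : Measure (EuclideanSpace ℝ (Fin 3))) := by
    intro S
    rw [Measure.volume_eq_prod, ← Measure.restrict_univ (μ := (volume : Measure (EuclideanSpace ℝ (Fin 3)))),
      Measure.prod_restrict, Measure.restrict_univ]
  -- (1) a.e. slice has the weak gradient `H t`
  have h1 : ∀ᵐ t ∂(volume.restrict (Iio T₁)),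
      HasWeakFDerivOn (⊤ : Opens (EuclideanSpace ℝ (Fin 3))) volume (u t) (H t) := FrameSteady.ae_hasWeakFDerivOn_slice_past hH hT₁
  -- (2) `|u(t)|² ∈ L¹_loc` for a.e. slice
  have h2 : ∀ᵐ t ∂(volume.restrict (Iio T₁)), LocallyIntegrable (fun x => ‖u t x‖ ^ 2) volume := by
    have hu2 : LocallyIntegrableOn (fun z => ‖uncurry u z‖ ^ 2)
        ((slab (EuclideanSpace ℝ (Fin 3)) (Iio 0) isOpen_Iio : Opens (ℝ × EuclideanSpace ℝ (Fin 3))) : Set (ℝ × EuclideanSpace ℝ (Fin 3))) volume :=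
      hdist.2.1
    have h := ae_slice_locallyIntegrable (g := fun z : ℝ × EuclideanSpace ℝ (Fin 3) => ‖uncurry u z‖ ^ 2)
      (fun K hK hKQ => hu2.integrableOn_compact_subset hKQ hK)
    rw [ae_restrict_iff' measurableSet_Iio]
    filter_upwards [h] with t ht htT
    exact ht (lt_of_lt_of_le htT hT₁)
  -- (3) `|H(t)|² ∈ L¹_loc` for a.e. slice (the class's `L²_loc` gradient agrees with `H` a.e.)
  have h3 : ∀ᵐ t ∂(volume.restrict (Iio T₁)), LocallyIntegrable (fun x => ‖H t x‖ ^ 2) volume := by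
    obtain ⟨G, hG, hG2, -⟩ := hsw.localEnergy
    have hae := hH.ae_eq hG
    have hHm : AEStronglyMeasurable (uncurry H)
        (volume.restrict ((slab (EuclideanSpace ℝ (Fin 3)) (Iio 0) isOpen_Iio : Opens (ℝ × EuclideanSpace ℝ (Fin 3))) :
          Set (ℝ × EuclideanSpace ℝ (Fin 3)))) := hH.locallyIntegrableOn_grad.aestronglyMeasurable
    have hK : ∀ K : Set (ℝ × EuclideanSpace ℝ (Fin 3)), IsCompact K →
        K ⊆ ((slab (EuclideanSpace ℝ (Fin 3)) (Iio 0) isOpen_Iio : Opens (ℝ × EuclideanSpace ℝ (Fin 3))) : Set (ℝ × EuclideanSpace ℝ (Fin 3))) →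
        IntegrableOn (fun z : ℝ × EuclideanSpace ℝ (Fin 3) => ‖uncurry H z‖ ^ 2) K volume := by
      intro K hKc hKQ
      have hm : AEStronglyMeasurable (fun z : ℝ × EuclideanSpace ℝ (Fin 3) => ‖uncurry H z‖ ^ 2) (volume.restrict K) :=
        ((hHm.mono_set hKQ).norm.pow 2)
      refine ⟨hm, ?_⟩
      have hfin := hG2 K hKQ hKc
      have haeK : ∀ᵐ z ∂(volume.restrict K), uncurry H z = uncurry G z := ae_restrict_of_ae_restrict_of_subset hKQ hae
      refine lt_of_le_of_lt ?_ hfin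
      refine lintegral_mono_ae ?_
      filter_upwards [haeK] with z hz
      rw [← ofReal_norm, norm_pow, norm_norm]
      refine ENNReal.ofReal_le_ofReal ?_
      have := norm_sq_le_frobeniusNormSq (G z.1 z.2)
      have e : uncurry H z = G z.1 z.2 := hz
      rw [e]
      exact this
    have h := ae_slice_locallyIntegrable (g := fun z : ℝ × EuclideanSpace ℝ (Fin 3) => ‖uncurry H z‖ ^ 2) hK
    rw [ae_restrict_iff' measurableSet_Iio]
    filter_upwards [h] with t ht htT
    exact ht (lt_of_lt_of_le htT hT₁)
  -- (4) trace-free slices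
  have h4 : ∀ᵐ t ∂(volume.restrict (Iio T₁)), ∀ᵐ x ∂(volume : Measure (EuclideanSpace ℝ (Fin 3))),
      ∑ j, ⟪(EuclideanSpace.basisFun (Fin 3) ℝ) j, H t x ((EuclideanSpace.basisFun (Fin 3) ℝ) j)⟫ = 0 := by
    have htr := SerrinBoundedHolder.ae_trace_eq_zero hdist hH
    have h' : ∀ᵐ z ∂(volume.restrict (Iio T₁ ×ˢ (univ : Set (EuclideanSpace ℝ (Fin 3))))),
        ∑ j, H z.1 z.2 (EuclideanSpace.single j (1 : ℝ)) j = 0 := by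
      rw [ae_restrict_iff' (measurableSet_Iio.prod MeasurableSet.univ)]
      filter_upwards [htr] with z hz hmem
      exact hz (by
        have : z.1 < 0 := lt_of_lt_of_le (mem_prod.1 hmem).1 hT₁
        simpa [slab] using this)
    rw [hprod] at h'
    filter_upwards [Measure.ae_ae_of_ae_prod h'] with t ht
    filter_upwards [ht] with x hx
    rw [← hx]
    refine Finset.sum_congr rfl fun j _ => ?_
    rw [EuclideanSpace.basisFun_apply, EuclideanSpace.inner_single_left]
    simp
  -- assemble: on a good slice, `∫⟪u, Dη u⟫ = −∫⟪η, H u⟫ = −∫ (⟪H u, η⟫ − ⟪H η, u⟫) − ∫⟪u, H η⟫ = 0 − 0`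
  refine Loc.ae_eq_zero_of_aeSliceLambCurlFree hρ hsw hH hgauge hT₁ ?_
  filter_upwards [h1, h2, h3, h4, hLamb] with t ht1 ht2 ht3 ht4 ht5
  intro g hg a c'
  have hη := isTestFunctionOn_curlPair hg a c'
  have hdivη := isDivFree_curlPair_of_contDiff (hg.contDiff.of_le (by norm_cast)) a c'
  rw [LambIdentity.integral_inner_fderiv_apply_self_eq ht1 ht2 ht3 hη]
  -- `L²`/test bookkeeping on a ball containing the support of `η`
  set b : OrthonormalBasis (Fin 3) ℝ (EuclideanSpace ℝ (Fin 3)) := EuclideanSpace.basisFun (Fin 3) ℝ with hb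
  set η : EuclideanSpace ℝ (Fin 3) → EuclideanSpace ℝ (Fin 3) := fun x => fderiv ℝ g x a • c' - fderiv ℝ g x c' • a with hηdef
  obtain ⟨R, hR⟩ := (hη.hasCompactSupport.isCompact).isBounded.subset_closedBall (0 : EuclideanSpace ℝ (Fin 3))
  set Ω : Set (EuclideanSpace ℝ (Fin 3)) := ball 0 (R + 1) with hΩ
  have hηΩ : tsupport η ⊆ Ω := hR.trans (closedBall_subset_ball (by linarith))
  have hGΩ : HasWeakFDerivOn (⟨Ω, isOpen_ball⟩ : Opens (EuclideanSpace ℝ (Fin 3))) volume (u t) (H t) :=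
    HasWeakFDerivOn.mono_set_holds ht1 le_top
  have hKc : IsCompact (closedBall (0 : EuclideanSpace ℝ (Fin 3)) (R + 1)) := isCompact_closedBall _ _
  have hsub : Ω ⊆ closedBall 0 (R + 1) := ball_subset_closedBall
  have hVm : AEStronglyMeasurable (u t) (volume.restrict Ω) := hGΩ.locallyIntegrableOn.aestronglyMeasurable
  have hGm : AEStronglyMeasurable (H t) (volume.restrict Ω) := hGΩ.locallyIntegrableOn_deriv.aestronglyMeasurable
  have hVL2 : MemLp (u t) 2 (volume.restrict Ω) :=
    (memLp_two_iff_integrable_sq_norm hVm).2 ((ht2.integrableOn_isCompact hKc).mono_set hsub)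
  have hGL2 : MemLp (H t) 2 (volume.restrict Ω) :=
    (memLp_two_iff_integrable_sq_norm hGm).2 ((ht3.integrableOn_isCompact hKc).mono_set hsub)
  have hcomp : ∀ v : EuclideanSpace ℝ (Fin 3), MemLp (fun x => ⟪u t x, v⟫) 2 (volume.restrict Ω) := by
    intro v
    refine MemLp.of_le_mul hVL2 (hVm.inner aestronglyMeasurable_const) (c := ‖v‖) (Eventually.of_forall fun x => ?_)
    rw [mul_comm]; exact norm_inner_le_norm _ _
  have hGcomp : ∀ v w : EuclideanSpace ℝ (Fin 3), MemLp (fun x => ⟪v, H t x w⟫) 2 (volume.restrict Ω) := by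
    intro v w
    have h1 : AEStronglyMeasurable (fun x => H t x w) (volume.restrict Ω) :=
      (ContinuousLinearMap.apply ℝ (EuclideanSpace ℝ (Fin 3)) w).continuous.comp_aestronglyMeasurable hGm
    refine MemLp.of_le_mul hGL2 (aestronglyMeasurable_const.inner h1) (c := ‖v‖ * ‖w‖) (Eventually.of_forall fun x => ?_)
    calc ‖⟪v, H t x w⟫‖ ≤ ‖v‖ * ‖H t x w‖ := norm_inner_le_norm _ _
      _ ≤ ‖v‖ * (‖H t x‖ * ‖w‖) := mul_le_mul_of_nonneg_left (ContinuousLinearMap.le_opNorm _ _) (norm_nonneg _)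
      _ = ‖v‖ * ‖w‖ * ‖H t x‖ := by ring
  have hφ : ∀ i, IsTestFunctionOn (⊤ : Opens (EuclideanSpace ℝ (Fin 3))) (fun x => ⟪b i, η x⟫) := fun i =>
    ⟨contDiff_const.inner ℝ hη.contDiff, hη.hasCompactSupport.mono (fun x hx => by intro h0; exact hx (by simp [h0])), by simp⟩
  have hφΩ : ∀ i, tsupport (fun x => ⟪b i, η x⟫) ⊆ Ω := by
    intro i
    have hs : support (fun x => ⟪b i, η x⟫) ⊆ tsupport η := fun x hx => by
      by_contra h0
      exact hx (by simp [image_eq_zero_of_notMem_tsupport h0])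
    exact (closure_minimal hs (isClosed_tsupport η)).trans hηΩ
  have hterm : ∀ i k v w, Integrable (fun x => ⟪b i, η x⟫ * (⟪u t x, b k⟫ * ⟪v, H t x w⟫)) volume := fun i k v w =>
    LambIdentity.integrable_mul_mul_of_memLp (hcomp (b k)) (hGcomp v w) (hφ i).contDiff.continuous (hφ i).hasCompactSupport (hφΩ i)
  -- `M = ⟪u, H η⟫` and `N = ⟪η, H u⟫` are integrable (double sums of such products)
  have hIM : Integrable (fun x => ⟪u t x, H t x (η x)⟫) volume := by
    have hsum := integrable_finsetSum (Finset.univ : Finset (Fin 3)) fun i _ =>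
      integrable_finsetSum (Finset.univ : Finset (Fin 3)) fun k _ => hterm i k (b k) (b i)
    refine hsum.congr (Eventually.of_forall fun x => ?_)
    show ∑ i, ∑ k, ⟪b i, η x⟫ * (⟪u t x, b k⟫ * ⟪b k, H t x (b i)⟫) = ⟪u t x, H t x (η x)⟫
    conv_rhs => rw [← b.sum_repr' (η x)]
    rw [map_sum, inner_sum]
    refine Finset.sum_congr rfl fun i _ => ?_
    rw [map_smul, inner_smul_right, ← b.sum_inner_mul_inner (u t x) (H t x (b i)), Finset.mul_sum]
  have hIN : Integrable (fun x => ⟪η x, H t x (u t x)⟫) volume := by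
    have hsum := integrable_finsetSum (Finset.univ : Finset (Fin 3)) fun i _ =>
      integrable_finsetSum (Finset.univ : Finset (Fin 3)) fun k _ => hterm i k (b i) (b k)
    refine hsum.congr (Eventually.of_forall fun x => ?_)
    show ∑ i, ∑ k, ⟪b i, η x⟫ * (⟪u t x, b k⟫ * ⟪b i, H t x (b k)⟫) = ⟪η x, H t x (u t x)⟫
    have hu : ∑ k, ⟪u t x, b k⟫ • b k = u t x := by
      conv_rhs => rw [← b.sum_repr' (u t x)]
      exact Finset.sum_congr rfl fun k _ => by rw [real_inner_comm]
    conv_rhs => rw [← hu]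
    rw [map_sum, inner_sum, Finset.sum_comm]
    refine Finset.sum_congr rfl fun k _ => ?_
    rw [map_smul, inner_smul_right, ← b.sum_inner_mul_inner (η x) (H t x (b k)), Finset.mul_sum]
    refine Finset.sum_congr rfl fun i _ => ?_
    rw [real_inner_comm (b i) (η x)]
    ring
  -- the identity, with `tr H = 0` a.e.
  have e1 : (fun x => ⟪η x, H t x (u t x)⟫ + ⟪u t x, η x⟫ * ∑ j, ⟪b j, H t x (b j)⟫) =ᵐ[volume]
      fun x => (⟪H t x (u t x), η x⟫ - ⟪H t x (η x), u t x⟫) + ⟪u t x, H t x (η x)⟫ := by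
    filter_upwards [ht4] with x hx
    rw [hx, mul_zero, add_zero, real_inner_comm (H t x (u t x)) (η x), real_inner_comm (H t x (η x)) (u t x)]
    ring
  have hIL : Integrable (fun x => ⟪H t x (u t x), η x⟫ - ⟪H t x (η x), u t x⟫) volume := by
    refine (hIN.sub hIM).congr (Eventually.of_forall fun x => ?_)
    simp only [Pi.sub_apply]
    rw [real_inner_comm (H t x (u t x)) (η x), real_inner_comm (H t x (η x)) (u t x)]
  rw [integral_congr_ae e1, integral_add hIL hIM, ht5 g hg a c', LambIdentity.integral_inner_apply_test_eq ht1 ht2 ht3 hη]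
  have h0 : ∀ x, VectorCalculus.divergence η x = 0 := hdivη
  simp [h0]

/-- **Binder language: NO MEMBER HAS A WEAKLY IRROTATIONAL LAMB VECTOR IN ITS FAR PAST** (generalised Beltrami, pointwise Lamb vector form): for a.e.
`t < T₁` (`T₁ ≤ 0`) the Lamb vector `(H − Hᵀ)u` of the slice annihilates all curl pairs, `∫ (⟪H u, η⟫ − ⟪H η, u⟫) = 0` ⇒ the member is trivial.
[folklore] -/
theorem Birth.nonSelfSimilar_of_aeLambGradientPast :
    ∀ ρ : ℝ, 0 < ρ →
      ∀ (u : ℝ → EuclideanSpace ℝ (Fin 3) → EuclideanSpace ℝ (Fin 3)) (p : ℝ → EuclideanSpace ℝ (Fin 3) → ℝ)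
        (H : ℝ → EuclideanSpace ℝ (Fin 3) → EuclideanSpace ℝ (Fin 3) →L[ℝ] EuclideanSpace ℝ (Fin 3)) (c : ℝ≥0),
        Birth.InClass ρ u p H c →
          (∃ T₁ : ℝ, T₁ ≤ 0 ∧ ∀ᵐ t ∂(volume.restrict (Iio T₁)),
              ∀ g : EuclideanSpace ℝ (Fin 3) → ℝ, IsTestFunctionOn (⊤ : Opens (EuclideanSpace ℝ (Fin 3))) g → ∀ a b : EuclideanSpace ℝ (Fin 3),
                ∫ x, (⟪H t x (u t x), fderiv ℝ g x a • b - fderiv ℝ g x b • a⟫ -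
                  ⟪H t x (fderiv ℝ g x a • b - fderiv ℝ g x b • a), u t x⟫) = 0) →
          uncurry u =ᵐ[volume.restrict (Iio (0 : ℝ) ×ˢ (univ : Set (EuclideanSpace ℝ (Fin 3))))] 0 := by
  intro ρ hρ u p H c hcl h
  obtain ⟨T₁, hT₁, hL⟩ := h
  exact Loc.ae_eq_zero_of_aeLambGradientPast hρ hcl.1 hcl.2.1 hcl.2.2 hT₁ hL

end Summit.NavierStokesRegularity.NavierStokesRegularity.Theorems.PowerGaugeEulerLiouville

end
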